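import Summits.BirchSwinnertonDyer.BirchSwinnertonDyer.Theorems.GenusKolyvaginAtTwoGenusPrimitiveSupplyAtTwoOfExactComponent
import Summits.BirchSwinnertonDyer.BirchSwinnertonDyer.Theorems.GenusKolyvaginAtTwoGenusPrimitiveSupplyAtTwoOfKernelsEll

/-!
# Route `GenusKolyvaginAtTwo`, crux `GenusPrimitiveSupplyAtTwo` (stmt-BirchSwinnertonDyer-22136), line `genus-supply`:
# the crux BY NAME from kernels RESTRICTED TO A SIDE CONDITION `C(E, d_K)` ON THE HEEGNER FIELD

Lead prover seat bsd-line-gk2-p1 (g3). CONDITIONAL; the crux stays OPEN; BSD is not proved by any of this.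

WHY (REPAIR CENSUS v1.2 §6, evidence #21). The open kernel U of the by-name closers `…_of_namedFacts_of_twoConverse_of_multiGenus`
(p593673) and `…_of_exactGenusComponent` (p597466) is typed in ∀K-form — a certificate for EVERY admissible Heegner field `K` whose twin
is rank-1 and `2`-Selmer-minimal. BSD-side (the cell's U-LEDGER (♣)/(♥) with gk2-p2's `DEF(E,K) = Σ_{q∣d_K} dim Ẽ(𝔽_q)[2] + [Δ_E>0]`)
that is too strong: at a `K` with `DEF ≥ 3` every genus component is even at every level, so no certificate exists although such `K` occur
on the habitat. The consistent kernel restricts `K` (e.g. to `DEF(E,K) = 1`). Since the composition of line `genus-supply` is UNIFORM in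
any side condition on `(E, d_K)`, this file proves it once for an ARBITRARY predicate `C : WeierstrassCurve ℚ → ℤ → Prop` (read at
`(W, d_K)`): (SUPPLY_C) «some admissible `K` with `C(W, d_K)` and a `2`-Selmer-minimal twin» ∧ (U_C) «for every admissible `K` WITH
`C(W, d_K)` … a certificate» ∧ Modularity ∧ `2`-parity ∧ Gross–Zagier ∧ (CONV₂) ⟹ the crux; and the same with the genus-component
kernel (X_C). The pen instantiates `C` with the tree-typed `DEF = 1` clause (gk2-p2's C⁗) — or any other consistent restriction — and
files SUPPLY_C / U_C as the items; the closer is then this theorem applied to `C`. Helper (`--supports stmt-BirchSwinnertonDyer-22136`).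
-/

set_option linter.dupNamespace false -- tree convention: `Summit.BirchSwinnertonDyer.BirchSwinnertonDyer.Theorems` (summit = sub-problem)

noncomputable section

open scoped Classical

namespace Summit.BirchSwinnertonDyer.BirchSwinnertonDyer.Theorems.GenusKoly

open Finset NumberField WeierstrassCurve Literature.NumberTheory.EllipticCurves
  Literature.NumberTheory.EllipticCurves.ModularForms

/-- **THE CRUX BY NAME FROM `C`-RESTRICTED KERNELS (multi-genus form).** For ANY side condition `C` on `(W, d_K)`: Modularity
(`exists_isNewformOf`) ∧ `2`-parity (`p_parity · 2`) ∧ Gross–Zagier (`gross_zagier`) ∧ (CONV₂) ∧ (SUPPLY_C) ∧ (U_C) ⟹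
`GenusPrimitiveSupplyAtTwo`. With `C := ⊤` this is `genusPrimitiveSupplyAtTwo_of_kernels` (g2); with `C := «DEF(W, d_K) = 1»` it is the
BSD-consistent split of REPAIR CENSUS v1.2. [cite: GrossLMS1991, §3 (3.5), Prop. 3.7 (1), §4 (4.1)] [cite: GrossZagier1986, Thm. I.6.3]
[cite: DokchitserDokchitserAnnals2010, Thm. 1.4] [cite: McCallumLMS1991, §5 Lemma 5.1] -/
theorem genusPrimitiveSupplyAtTwo_of_twoConverse_of_restrictedKernels (C : WeierstrassCurve ℚ → ℤ → Prop)
    (hmod : exists_isNewformOf) (hpar : ∀ V : WeierstrassCurve ℚ, p_parity V 2)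
    (hGZ : ∀ (W : WeierstrassCurve ℚ) [NeZero (W.conductorNorm ℤ)] (K : Type) [Field K] [NumberField K],
      gross_zagier (W.conductorNorm ℤ) W K)
    (hconv : ∀ (V : WeierstrassCurve ℚ) [V.IsElliptic] [V.IsGloballyMinimal],
      ¬ V.HasCM → V.selmerCorank 2 = 1 → V.analyticRank = 1)
    (hsupplyC : ∀ (W : WeierstrassCurve ℚ) [W.IsElliptic] [W.IsGloballyMinimal] [NeZero (W.conductorNorm ℤ)],
      ¬ W.HasCM → W.analyticRank = 0 → (∀ n : ℕ, 0 < n → W.HasSurjectiveModNGaloisRep ((2 : ℤ) ^ n)) →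
      Odd W.tamagawaProduct →
      ∃ (K : Type) (_ : Field K) (_ : NumberField K),
        IsImaginaryQuadratic K ∧ Odd (NumberField.discr K) ∧ NumberField.discr K ≠ -3 ∧
        SatisfiesHeegnerHypothesis (W.conductorNorm ℤ) K ∧
        ¬ IsSquare ((NumberField.discr K : ℚ) * -|W.Δ|) ∧ ¬ IsSquare ((NumberField.discr K : ℚ) * (-(2 * |W.Δ|))) ∧
        C W (NumberField.discr K) ∧
        ∃ (Wd : WeierstrassCurve ℚ) (_ : Wd.IsElliptic) (_ : Wd.IsGloballyMinimal),
          (∃ C' : WeierstrassCurve.VariableChange ℚ, C' • W.quadraticTwist (NumberField.discr K : ℚ) = Wd) ∧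
          Nat.card (Wd.selmerGroup 2) = 2)
    (hUC : ∀ (W : WeierstrassCurve ℚ) [W.IsElliptic] [W.IsGloballyMinimal] [NeZero (W.conductorNorm ℤ)],
      ¬ W.HasCM → W.analyticRank = 0 → (∀ n : ℕ, 0 < n → W.HasSurjectiveModNGaloisRep ((2 : ℤ) ^ n)) →
      Odd W.tamagawaProduct →
      ∀ (K : Type) [Field K] [NumberField K],
      IsImaginaryQuadratic K → Odd (NumberField.discr K) → NumberField.discr K ≠ -3 →
      SatisfiesHeegnerHypothesis (W.conductorNorm ℤ) K →
      ¬ IsSquare ((NumberField.discr K : ℚ) * -|W.Δ|) → ¬ IsSquare ((NumberField.discr K : ℚ) * (-(2 * |W.Δ|))) →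
      C W (NumberField.discr K) →
      ∀ (Dt : ModularParametrizationData W (W.conductorNorm ℤ)),
      (∀ z ∈ Dt.L.lattice, ∃ w ∈ periodLattice Dt.f, z = (Dt.c : ℂ) * w) → Odd Dt.c →
      ∀ (β : ℤ) (ι : K →+* ℂ) (d₁ : KolyvaginHeegnerData Dt β ι 1), ¬ IsOfFinAddOrder d₁.derivedPoint →
      ∀ (Wd : WeierstrassCurve ℚ) [Wd.IsElliptic] [Wd.IsGloballyMinimal],
      (∃ C' : WeierstrassCurve.VariableChange ℚ, C' • W.quadraticTwist (NumberField.discr K : ℚ) = Wd) →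
      Wd.analyticRank = 1 → Nat.card (Wd.selmerGroup 2) = 2 →
      ∃ (n : ℕ) (d : KolyvaginHeegnerData Dt β ι n) (θ : ℕ → ringClassField K ι n)
        (T : Finset (ringClassField K ι n ≃ₐ[ℚ] ringClassField K ι n)), Squarefree n ∧
        (∀ ℓ ∈ n.primeFactors, Zhang2014.IsKolyvaginPrime (W.conductorNorm ℤ) W K 2 ℓ) ∧
        (∀ ℓ ∈ n.primeFactors, θ ℓ ^ 2 = algebraMap ℚ (ringClassField K ι n) ((-1 : ℚ) ^ (ℓ / 2) * ℓ)) ∧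
        (∀ g, g ∈ T ↔ g ∈ ringClassGal ι n ∧ ∀ ℓ ∈ n.primeFactors, g (θ ℓ) = θ ℓ) ∧
        ¬ ∃ Q : (W.baseChange (ringClassField K ι n)).toAffine.Point, (2 : ℤ) • Q =
          ∑ g ∈ T, pointGalHom W (ringClassField K ι n) g d.y) :
    Summit.BirchSwinnertonDyer.BirchSwinnertonDyer.Theses.GenusKolyvaginAtTwo.GenusPrimitiveSupplyAtTwo := by
  intro W _ _ _ hcm hr0 hρ hT hopt
  -- A_C = SUPPLY_C + CONV₂ (pointwise chain of `…TwinConverse`)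
  obtain ⟨K, iF, iN, hIQ, hodd, h3, hHe, hsq1, hsq2, hC, Wd, iE, iM, hWd, hSel⟩ := hsupplyC W hcm hr0 hρ hT
  have hd : (NumberField.discr K : ℚ) ≠ 0 := by exact_mod_cast NumberField.discr_ne_zero K
  have hcmd : ¬ Wd.HasCM := twin_not_hasCM W hcm hd Wd hWd
  have hrd : Wd.analyticRank = 1 :=
    hconv Wd hcmd (selmerCorank_two_eq_one_of_card_selmerGroup_two Wd
      (natCard_twoTorsion_twin_eq_one W (hρ 1 one_pos) hd Wd hWd) hSel
      (odd_selmerCorank_two_of_p_parity Wd (hpar Wd) (rootNumber_twin_eq_neg_one hmod W hr0 K hIQ hHe Wd hWd)))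
  -- glue: orientation, embedding, conductor-`1` datum
  obtain ⟨Dt, hoptDt, hc⟩ := hopt
  obtain ⟨β, hβ⟩ : ∃ β : ℤ, (4 * (W.conductorNorm ℤ : ℕ) : ℤ) ∣ β ^ 2 - NumberField.discr K :=
    Literature.NumberTheory.QuadraticFields.Quadratic.exists_dvd_sq_sub_discr_of_ncard_primesOver hIQ.1 (NeZero.ne _) hHe
  obtain ⟨ι⟩ : Nonempty (K →+* ℂ) := inferInstance
  obtain ⟨d₁⟩ := exists_kolyvaginHeegnerData_one
    (phi_heegnerTau_mem_singularModuliField_holds (W.conductorNorm ℤ) W K) hIQ Dt β ι hβ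
  haveI := W.isElliptic_quadraticTwist hd
  have hrtw : (W.quadraticTwist (NumberField.discr K : ℚ)).analyticRank = 1 := by
    obtain ⟨C', hC'⟩ := hWd
    rw [← analyticRank_smul (W.quadraticTwist (NumberField.discr K : ℚ)) C', hC']
    exact hrd
  -- B = Gross–Zagier alone
  have hy : ¬ IsOfFinAddOrder d₁.derivedPoint := stub_heegnerNonTorsionAtTwo_of_grossZagier hGZ W K hIQ hHe hr0 hrtw Dt β ι d₁
  obtain ⟨M₀, hdiv, hndiv⟩ := exists_exactTwoDivisibility_of_not_isOfFinAddOrder W hIQ Dt β ι d₁ hy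
  -- C = U_C through the intrinsic dictionary
  obtain ⟨n, d, hn, hKoly, hPn⟩ := exists_derivedPoint_not_two_dvd_of_multiGenusTrace hIQ hodd h3 hHe
    (hUC W hcm hr0 hρ hT K hIQ hodd h3 hHe hsq1 hsq2 hC Dt hoptDt hc β ι d₁ hy Wd hWd hrd hSel)
  exact ⟨K, iF, iN, hIQ, hodd, h3, hHe, hsq1, hsq2, Dt, β, ι, d₁, hoptDt, hc, hy, M₀, hdiv, hndiv, n, d, hn, hKoly, hPn,
    Wd, iE, iM, hWd, hcmd, hrd, hSel⟩

/-- **THE CRUX BY NAME FROM `C`-RESTRICTED KERNELS (genus-component form (X_C)).** Same, with the kernel in the currency of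
the genus-character Heegner points: for every admissible `K` WITH `C(W, d_K)` …, some square-free `n` of Kolyvagin primes at `2`, an
enumeration `G` of `Gal(K[n]/K)` and some `M₀ ⊆ {ℓ∣n}` with all components `Y_M` (`M ≠ M₀`) in `2^{r+1}E(K[n])` and
`Y_{M₀} ∉ 2^{r+1}E(K[n])`. [cite: GrossLMS1991, §3 (3.5), §4 (4.1)] [cite: McCallumLMS1991, §5] -/
theorem genusPrimitiveSupplyAtTwo_of_twoConverse_of_restrictedExactGenusComponent (C : WeierstrassCurve ℚ → ℤ → Prop)
    (hmod : exists_isNewformOf) (hpar : ∀ V : WeierstrassCurve ℚ, p_parity V 2)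
    (hGZ : ∀ (W : WeierstrassCurve ℚ) [NeZero (W.conductorNorm ℤ)] (K : Type) [Field K] [NumberField K],
      gross_zagier (W.conductorNorm ℤ) W K)
    (hconv : ∀ (V : WeierstrassCurve ℚ) [V.IsElliptic] [V.IsGloballyMinimal],
      ¬ V.HasCM → V.selmerCorank 2 = 1 → V.analyticRank = 1)
    (hsupplyC : ∀ (W : WeierstrassCurve ℚ) [W.IsElliptic] [W.IsGloballyMinimal] [NeZero (W.conductorNorm ℤ)],
      ¬ W.HasCM → W.analyticRank = 0 → (∀ n : ℕ, 0 < n → W.HasSurjectiveModNGaloisRep ((2 : ℤ) ^ n)) →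
      Odd W.tamagawaProduct →
      ∃ (K : Type) (_ : Field K) (_ : NumberField K),
        IsImaginaryQuadratic K ∧ Odd (NumberField.discr K) ∧ NumberField.discr K ≠ -3 ∧
        SatisfiesHeegnerHypothesis (W.conductorNorm ℤ) K ∧
        ¬ IsSquare ((NumberField.discr K : ℚ) * -|W.Δ|) ∧ ¬ IsSquare ((NumberField.discr K : ℚ) * (-(2 * |W.Δ|))) ∧
        C W (NumberField.discr K) ∧
        ∃ (Wd : WeierstrassCurve ℚ) (_ : Wd.IsElliptic) (_ : Wd.IsGloballyMinimal),
          (∃ C' : WeierstrassCurve.VariableChange ℚ, C' • W.quadraticTwist (NumberField.discr K : ℚ) = Wd) ∧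
          Nat.card (Wd.selmerGroup 2) = 2)
    (hXC : ∀ (W : WeierstrassCurve ℚ) [W.IsElliptic] [W.IsGloballyMinimal] [NeZero (W.conductorNorm ℤ)],
      ¬ W.HasCM → W.analyticRank = 0 → (∀ n : ℕ, 0 < n → W.HasSurjectiveModNGaloisRep ((2 : ℤ) ^ n)) →
      Odd W.tamagawaProduct →
      ∀ (K : Type) [Field K] [NumberField K],
      IsImaginaryQuadratic K → Odd (NumberField.discr K) → NumberField.discr K ≠ -3 →
      SatisfiesHeegnerHypothesis (W.conductorNorm ℤ) K →
      ¬ IsSquare ((NumberField.discr K : ℚ) * -|W.Δ|) → ¬ IsSquare ((NumberField.discr K : ℚ) * (-(2 * |W.Δ|))) →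
      C W (NumberField.discr K) →
      ∀ (Dt : ModularParametrizationData W (W.conductorNorm ℤ)),
      (∀ z ∈ Dt.L.lattice, ∃ w ∈ periodLattice Dt.f, z = (Dt.c : ℂ) * w) → Odd Dt.c →
      ∀ (β : ℤ) (ι : K →+* ℂ) (d₁ : KolyvaginHeegnerData Dt β ι 1), ¬ IsOfFinAddOrder d₁.derivedPoint →
      ∀ (Wd : WeierstrassCurve ℚ) [Wd.IsElliptic] [Wd.IsGloballyMinimal],
      (∃ C' : WeierstrassCurve.VariableChange ℚ, C' • W.quadraticTwist (NumberField.discr K : ℚ) = Wd) →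
      Wd.analyticRank = 1 → Nat.card (Wd.selmerGroup 2) = 2 →
      ∃ (n : ℕ) (d : KolyvaginHeegnerData Dt β ι n) (θ : ℕ → ringClassField K ι n)
        (G : Finset (ringClassField K ι n ≃ₐ[ℚ] ringClassField K ι n)) (M₀ : Finset ℕ), Squarefree n ∧
        (∀ ℓ ∈ n.primeFactors, Zhang2014.IsKolyvaginPrime (W.conductorNorm ℤ) W K 2 ℓ) ∧
        (∀ ℓ ∈ n.primeFactors, θ ℓ ^ 2 = algebraMap ℚ (ringClassField K ι n) ((-1 : ℚ) ^ (ℓ / 2) * ℓ)) ∧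
        (∀ g, g ∈ G ↔ g ∈ ringClassGal ι n) ∧ M₀ ∈ n.primeFactors.powerset ∧
        (∀ M ∈ n.primeFactors.powerset, M ≠ M₀ → ∃ Q : (W.baseChange (ringClassField K ι n)).toAffine.Point,
          ((2 : ℤ) ^ (n.primeFactors.card + 1)) • Q =
            ∑ g ∈ G, (∏ ℓ ∈ M, (if g (θ ℓ) = θ ℓ then (1 : ℤ) else -1)) • pointGalHom W (ringClassField K ι n) g d.y) ∧
        ¬ ∃ Q : (W.baseChange (ringClassField K ι n)).toAffine.Point, ((2 : ℤ) ^ (n.primeFactors.card + 1)) • Q =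
          ∑ g ∈ G, (∏ ℓ ∈ M₀, (if g (θ ℓ) = θ ℓ then (1 : ℤ) else -1)) • pointGalHom W (ringClassField K ι n) g d.y) :
    Summit.BirchSwinnertonDyer.BirchSwinnertonDyer.Theses.GenusKolyvaginAtTwo.GenusPrimitiveSupplyAtTwo := by
  refine genusPrimitiveSupplyAtTwo_of_twoConverse_of_restrictedKernels C hmod hpar hGZ hconv hsupplyC ?_
  intro W _ _ _ hcm hr0 hρ hT K _ _ hIQ hodd h3 hHe hsq1 hsq2 hC Dt hoptDt hc β ι d₁ hy Wd _ _ hWd hrd hSel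
  obtain ⟨n, d, θ, G, M₀, hn, hKoly, hθ, hG, hM₀, hdeep, hexact⟩ :=
    hXC W hcm hr0 hρ hT K hIQ hodd h3 hHe hsq1 hsq2 hC Dt hoptDt hc β ι d₁ hy Wd hWd hrd hSel
  refine ⟨n, d, θ, G.filter (fun g ↦ ∀ ℓ ∈ n.primeFactors, g (θ ℓ) = θ ℓ), hn, hKoly, hθ,
    fun g ↦ by rw [Finset.mem_filter, hG], ?_⟩
  exact heegner_not_exists_two_zsmul_eq_multiGenusTrace_of_exactComponent hIQ hodd hHe (by simpa using hρ 1 one_pos)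
    hn.ne_zero d θ G hG _ (fun g ↦ by rw [Finset.mem_filter, hG]) hM₀ hdeep hexact

/-! ## R-128 retype (director-bsd 2026-08-29 17:42Z, T-Q381-1′; seat bsd-line-gk2-p2 g21): PRINT-FORM TWINS
Every theorem below is the byte-identical twin of the theorem of the same name without the trailing prime, with the ONE change
that the `2`-parity hypothesis is typed as print has it — `∀ (V : WeierstrassCurve ℚ) [V.IsElliptic], p_parity V 2`
(Dokchitser–Dokchitser 2010 Thm. 1.4, elliptic curves; = route item `TwoParityDD` after rev 34) — instead of the bare closure
`∀ V : WeierstrassCurve ℚ, p_parity V 2` over all Weierstrass cubics (singular ones included: off print, undischargeable).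
Calls to other retyped theorems go to their primed twins; every application `hpar W` is at an elliptic curve, so the proofs are
unchanged. The unprimed originals are kept (append-only tree) and are superseded by these. BSD is NOT proved by any of this. -/

/-- **R-128 retype** (director-bsd 2026-08-29, T-Q381-1′) of `genusPrimitiveSupplyAtTwo_of_twoConverse_of_restrictedKernels`: the SAME statement and proof with the `2`-parity hypothesis in PRINT form `∀ (V : WeierstrassCurve ℚ) [V.IsElliptic], p_parity V 2` (Dokchitser–Dokchitser 2010 Thm. 1.4 is about elliptic curves; the bare closure over all Weierstrass cubics was off print). **THE CRUX BY NAME FROM `C`-RESTRICTED KERNELS (multi-genus form).** For ANY side condition `C` on `(W, d_K)`: Modularity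
(`exists_isNewformOf`) ∧ `2`-parity (`p_parity · 2`) ∧ Gross–Zagier (`gross_zagier`) ∧ (CONV₂) ∧ (SUPPLY_C) ∧ (U_C) ⟹
`GenusPrimitiveSupplyAtTwo`. With `C := ⊤` this is `genusPrimitiveSupplyAtTwo_of_kernels'` (g2); with `C := «DEF(W, d_K) = 1»` it is the
BSD-consistent split of REPAIR CENSUS v1.2. [cite: GrossLMS1991, §3 (3.5), Prop. 3.7 (1), §4 (4.1)] [cite: GrossZagier1986, Thm. I.6.3]
[cite: DokchitserDokchitserAnnals2010, Thm. 1.4] [cite: McCallumLMS1991, §5 Lemma 5.1] -/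
theorem genusPrimitiveSupplyAtTwo_of_twoConverse_of_restrictedKernels' (C : WeierstrassCurve ℚ → ℤ → Prop)
    (hmod : exists_isNewformOf) (hpar : ∀ (V : WeierstrassCurve ℚ) [V.IsElliptic], p_parity V 2)
    (hGZ : ∀ (W : WeierstrassCurve ℚ) [NeZero (W.conductorNorm ℤ)] (K : Type) [Field K] [NumberField K],
      gross_zagier (W.conductorNorm ℤ) W K)
    (hconv : ∀ (V : WeierstrassCurve ℚ) [V.IsElliptic] [V.IsGloballyMinimal],
      ¬ V.HasCM → V.selmerCorank 2 = 1 → V.analyticRank = 1)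
    (hsupplyC : ∀ (W : WeierstrassCurve ℚ) [W.IsElliptic] [W.IsGloballyMinimal] [NeZero (W.conductorNorm ℤ)],
      ¬ W.HasCM → W.analyticRank = 0 → (∀ n : ℕ, 0 < n → W.HasSurjectiveModNGaloisRep ((2 : ℤ) ^ n)) →
      Odd W.tamagawaProduct →
      ∃ (K : Type) (_ : Field K) (_ : NumberField K),
        IsImaginaryQuadratic K ∧ Odd (NumberField.discr K) ∧ NumberField.discr K ≠ -3 ∧
        SatisfiesHeegnerHypothesis (W.conductorNorm ℤ) K ∧
        ¬ IsSquare ((NumberField.discr K : ℚ) * -|W.Δ|) ∧ ¬ IsSquare ((NumberField.discr K : ℚ) * (-(2 * |W.Δ|))) ∧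
        C W (NumberField.discr K) ∧
        ∃ (Wd : WeierstrassCurve ℚ) (_ : Wd.IsElliptic) (_ : Wd.IsGloballyMinimal),
          (∃ C' : WeierstrassCurve.VariableChange ℚ, C' • W.quadraticTwist (NumberField.discr K : ℚ) = Wd) ∧
          Nat.card (Wd.selmerGroup 2) = 2)
    (hUC : ∀ (W : WeierstrassCurve ℚ) [W.IsElliptic] [W.IsGloballyMinimal] [NeZero (W.conductorNorm ℤ)],
      ¬ W.HasCM → W.analyticRank = 0 → (∀ n : ℕ, 0 < n → W.HasSurjectiveModNGaloisRep ((2 : ℤ) ^ n)) →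
      Odd W.tamagawaProduct →
      ∀ (K : Type) [Field K] [NumberField K],
      IsImaginaryQuadratic K → Odd (NumberField.discr K) → NumberField.discr K ≠ -3 →
      SatisfiesHeegnerHypothesis (W.conductorNorm ℤ) K →
      ¬ IsSquare ((NumberField.discr K : ℚ) * -|W.Δ|) → ¬ IsSquare ((NumberField.discr K : ℚ) * (-(2 * |W.Δ|))) →
      C W (NumberField.discr K) →
      ∀ (Dt : ModularParametrizationData W (W.conductorNorm ℤ)),
      (∀ z ∈ Dt.L.lattice, ∃ w ∈ periodLattice Dt.f, z = (Dt.c : ℂ) * w) → Odd Dt.c →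
      ∀ (β : ℤ) (ι : K →+* ℂ) (d₁ : KolyvaginHeegnerData Dt β ι 1), ¬ IsOfFinAddOrder d₁.derivedPoint →
      ∀ (Wd : WeierstrassCurve ℚ) [Wd.IsElliptic] [Wd.IsGloballyMinimal],
      (∃ C' : WeierstrassCurve.VariableChange ℚ, C' • W.quadraticTwist (NumberField.discr K : ℚ) = Wd) →
      Wd.analyticRank = 1 → Nat.card (Wd.selmerGroup 2) = 2 →
      ∃ (n : ℕ) (d : KolyvaginHeegnerData Dt β ι n) (θ : ℕ → ringClassField K ι n)
        (T : Finset (ringClassField K ι n ≃ₐ[ℚ] ringClassField K ι n)), Squarefree n ∧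
        (∀ ℓ ∈ n.primeFactors, Zhang2014.IsKolyvaginPrime (W.conductorNorm ℤ) W K 2 ℓ) ∧
        (∀ ℓ ∈ n.primeFactors, θ ℓ ^ 2 = algebraMap ℚ (ringClassField K ι n) ((-1 : ℚ) ^ (ℓ / 2) * ℓ)) ∧
        (∀ g, g ∈ T ↔ g ∈ ringClassGal ι n ∧ ∀ ℓ ∈ n.primeFactors, g (θ ℓ) = θ ℓ) ∧
        ¬ ∃ Q : (W.baseChange (ringClassField K ι n)).toAffine.Point, (2 : ℤ) • Q =
          ∑ g ∈ T, pointGalHom W (ringClassField K ι n) g d.y) :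
    Summit.BirchSwinnertonDyer.BirchSwinnertonDyer.Theses.GenusKolyvaginAtTwo.GenusPrimitiveSupplyAtTwo := by
  intro W _ _ _ hcm hr0 hρ hT hopt
  -- A_C = SUPPLY_C + CONV₂ (pointwise chain of `…TwinConverse`)
  obtain ⟨K, iF, iN, hIQ, hodd, h3, hHe, hsq1, hsq2, hC, Wd, iE, iM, hWd, hSel⟩ := hsupplyC W hcm hr0 hρ hT
  have hd : (NumberField.discr K : ℚ) ≠ 0 := by exact_mod_cast NumberField.discr_ne_zero K
  have hcmd : ¬ Wd.HasCM := twin_not_hasCM W hcm hd Wd hWd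
  have hrd : Wd.analyticRank = 1 :=
    hconv Wd hcmd (selmerCorank_two_eq_one_of_card_selmerGroup_two Wd
      (natCard_twoTorsion_twin_eq_one W (hρ 1 one_pos) hd Wd hWd) hSel
      (odd_selmerCorank_two_of_p_parity Wd (hpar Wd) (rootNumber_twin_eq_neg_one hmod W hr0 K hIQ hHe Wd hWd)))
  -- glue: orientation, embedding, conductor-`1` datum
  obtain ⟨Dt, hoptDt, hc⟩ := hopt
  obtain ⟨β, hβ⟩ : ∃ β : ℤ, (4 * (W.conductorNorm ℤ : ℕ) : ℤ) ∣ β ^ 2 - NumberField.discr K :=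
    Literature.NumberTheory.QuadraticFields.Quadratic.exists_dvd_sq_sub_discr_of_ncard_primesOver hIQ.1 (NeZero.ne _) hHe
  obtain ⟨ι⟩ : Nonempty (K →+* ℂ) := inferInstance
  obtain ⟨d₁⟩ := exists_kolyvaginHeegnerData_one
    (phi_heegnerTau_mem_singularModuliField_holds (W.conductorNorm ℤ) W K) hIQ Dt β ι hβ
  haveI := W.isElliptic_quadraticTwist hd
  have hrtw : (W.quadraticTwist (NumberField.discr K : ℚ)).analyticRank = 1 := by
    obtain ⟨C', hC'⟩ := hWd
    rw [← analyticRank_smul (W.quadraticTwist (NumberField.discr K : ℚ)) C', hC']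
    exact hrd
  -- B = Gross–Zagier alone
  have hy : ¬ IsOfFinAddOrder d₁.derivedPoint := stub_heegnerNonTorsionAtTwo_of_grossZagier hGZ W K hIQ hHe hr0 hrtw Dt β ι d₁
  obtain ⟨M₀, hdiv, hndiv⟩ := exists_exactTwoDivisibility_of_not_isOfFinAddOrder W hIQ Dt β ι d₁ hy
  -- C = U_C through the intrinsic dictionary
  obtain ⟨n, d, hn, hKoly, hPn⟩ := exists_derivedPoint_not_two_dvd_of_multiGenusTrace hIQ hodd h3 hHe
    (hUC W hcm hr0 hρ hT K hIQ hodd h3 hHe hsq1 hsq2 hC Dt hoptDt hc β ι d₁ hy Wd hWd hrd hSel)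
  exact ⟨K, iF, iN, hIQ, hodd, h3, hHe, hsq1, hsq2, Dt, β, ι, d₁, hoptDt, hc, hy, M₀, hdiv, hndiv, n, d, hn, hKoly, hPn,
    Wd, iE, iM, hWd, hcmd, hrd, hSel⟩

/-- **R-128 retype** (director-bsd 2026-08-29, T-Q381-1′) of `genusPrimitiveSupplyAtTwo_of_twoConverse_of_restrictedExactGenusComponent`: the SAME statement and proof with the `2`-parity hypothesis in PRINT form `∀ (V : WeierstrassCurve ℚ) [V.IsElliptic], p_parity V 2` (Dokchitser–Dokchitser 2010 Thm. 1.4 is about elliptic curves; the bare closure over all Weierstrass cubics was off print). **THE CRUX BY NAME FROM `C`-RESTRICTED KERNELS (genus-component form (X_C)).** Same, with the kernel in the currency of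
the genus-character Heegner points: for every admissible `K` WITH `C(W, d_K)` …, some square-free `n` of Kolyvagin primes at `2`, an
enumeration `G` of `Gal(K[n]/K)` and some `M₀ ⊆ {ℓ∣n}` with all components `Y_M` (`M ≠ M₀`) in `2^{r+1}E(K[n])` and
`Y_{M₀} ∉ 2^{r+1}E(K[n])`. [cite: GrossLMS1991, §3 (3.5), §4 (4.1)] [cite: McCallumLMS1991, §5] -/
theorem genusPrimitiveSupplyAtTwo_of_twoConverse_of_restrictedExactGenusComponent' (C : WeierstrassCurve ℚ → ℤ → Prop)
    (hmod : exists_isNewformOf) (hpar : ∀ (V : WeierstrassCurve ℚ) [V.IsElliptic], p_parity V 2)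
    (hGZ : ∀ (W : WeierstrassCurve ℚ) [NeZero (W.conductorNorm ℤ)] (K : Type) [Field K] [NumberField K],
      gross_zagier (W.conductorNorm ℤ) W K)
    (hconv : ∀ (V : WeierstrassCurve ℚ) [V.IsElliptic] [V.IsGloballyMinimal],
      ¬ V.HasCM → V.selmerCorank 2 = 1 → V.analyticRank = 1)
    (hsupplyC : ∀ (W : WeierstrassCurve ℚ) [W.IsElliptic] [W.IsGloballyMinimal] [NeZero (W.conductorNorm ℤ)],
      ¬ W.HasCM → W.analyticRank = 0 → (∀ n : ℕ, 0 < n → W.HasSurjectiveModNGaloisRep ((2 : ℤ) ^ n)) →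
      Odd W.tamagawaProduct →
      ∃ (K : Type) (_ : Field K) (_ : NumberField K),
        IsImaginaryQuadratic K ∧ Odd (NumberField.discr K) ∧ NumberField.discr K ≠ -3 ∧
        SatisfiesHeegnerHypothesis (W.conductorNorm ℤ) K ∧
        ¬ IsSquare ((NumberField.discr K : ℚ) * -|W.Δ|) ∧ ¬ IsSquare ((NumberField.discr K : ℚ) * (-(2 * |W.Δ|))) ∧
        C W (NumberField.discr K) ∧
        ∃ (Wd : WeierstrassCurve ℚ) (_ : Wd.IsElliptic) (_ : Wd.IsGloballyMinimal),
          (∃ C' : WeierstrassCurve.VariableChange ℚ, C' • W.quadraticTwist (NumberField.discr K : ℚ) = Wd) ∧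
          Nat.card (Wd.selmerGroup 2) = 2)
    (hXC : ∀ (W : WeierstrassCurve ℚ) [W.IsElliptic] [W.IsGloballyMinimal] [NeZero (W.conductorNorm ℤ)],
      ¬ W.HasCM → W.analyticRank = 0 → (∀ n : ℕ, 0 < n → W.HasSurjectiveModNGaloisRep ((2 : ℤ) ^ n)) →
      Odd W.tamagawaProduct →
      ∀ (K : Type) [Field K] [NumberField K],
      IsImaginaryQuadratic K → Odd (NumberField.discr K) → NumberField.discr K ≠ -3 →
      SatisfiesHeegnerHypothesis (W.conductorNorm ℤ) K →
      ¬ IsSquare ((NumberField.discr K : ℚ) * -|W.Δ|) → ¬ IsSquare ((NumberField.discr K : ℚ) * (-(2 * |W.Δ|))) →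
      C W (NumberField.discr K) →
      ∀ (Dt : ModularParametrizationData W (W.conductorNorm ℤ)),
      (∀ z ∈ Dt.L.lattice, ∃ w ∈ periodLattice Dt.f, z = (Dt.c : ℂ) * w) → Odd Dt.c →
      ∀ (β : ℤ) (ι : K →+* ℂ) (d₁ : KolyvaginHeegnerData Dt β ι 1), ¬ IsOfFinAddOrder d₁.derivedPoint →
      ∀ (Wd : WeierstrassCurve ℚ) [Wd.IsElliptic] [Wd.IsGloballyMinimal],
      (∃ C' : WeierstrassCurve.VariableChange ℚ, C' • W.quadraticTwist (NumberField.discr K : ℚ) = Wd) →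
      Wd.analyticRank = 1 → Nat.card (Wd.selmerGroup 2) = 2 →
      ∃ (n : ℕ) (d : KolyvaginHeegnerData Dt β ι n) (θ : ℕ → ringClassField K ι n)
        (G : Finset (ringClassField K ι n ≃ₐ[ℚ] ringClassField K ι n)) (M₀ : Finset ℕ), Squarefree n ∧
        (∀ ℓ ∈ n.primeFactors, Zhang2014.IsKolyvaginPrime (W.conductorNorm ℤ) W K 2 ℓ) ∧
        (∀ ℓ ∈ n.primeFactors, θ ℓ ^ 2 = algebraMap ℚ (ringClassField K ι n) ((-1 : ℚ) ^ (ℓ / 2) * ℓ)) ∧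
        (∀ g, g ∈ G ↔ g ∈ ringClassGal ι n) ∧ M₀ ∈ n.primeFactors.powerset ∧
        (∀ M ∈ n.primeFactors.powerset, M ≠ M₀ → ∃ Q : (W.baseChange (ringClassField K ι n)).toAffine.Point,
          ((2 : ℤ) ^ (n.primeFactors.card + 1)) • Q =
            ∑ g ∈ G, (∏ ℓ ∈ M, (if g (θ ℓ) = θ ℓ then (1 : ℤ) else -1)) • pointGalHom W (ringClassField K ι n) g d.y) ∧
        ¬ ∃ Q : (W.baseChange (ringClassField K ι n)).toAffine.Point, ((2 : ℤ) ^ (n.primeFactors.card + 1)) • Q =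
          ∑ g ∈ G, (∏ ℓ ∈ M₀, (if g (θ ℓ) = θ ℓ then (1 : ℤ) else -1)) • pointGalHom W (ringClassField K ι n) g d.y) :
    Summit.BirchSwinnertonDyer.BirchSwinnertonDyer.Theses.GenusKolyvaginAtTwo.GenusPrimitiveSupplyAtTwo := by
  refine genusPrimitiveSupplyAtTwo_of_twoConverse_of_restrictedKernels' C hmod hpar hGZ hconv hsupplyC ?_
  intro W _ _ _ hcm hr0 hρ hT K _ _ hIQ hodd h3 hHe hsq1 hsq2 hC Dt hoptDt hc β ι d₁ hy Wd _ _ hWd hrd hSel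
  obtain ⟨n, d, θ, G, M₀, hn, hKoly, hθ, hG, hM₀, hdeep, hexact⟩ :=
    hXC W hcm hr0 hρ hT K hIQ hodd h3 hHe hsq1 hsq2 hC Dt hoptDt hc β ι d₁ hy Wd hWd hrd hSel
  refine ⟨n, d, θ, G.filter (fun g ↦ ∀ ℓ ∈ n.primeFactors, g (θ ℓ) = θ ℓ), hn, hKoly, hθ,
    fun g ↦ by rw [Finset.mem_filter, hG], ?_⟩
  exact heegner_not_exists_two_zsmul_eq_multiGenusTrace_of_exactComponent hIQ hodd hHe (by simpa using hρ 1 one_pos)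
    hn.ne_zero d θ G hG _ (fun g ↦ by rw [Finset.mem_filter, hG]) hM₀ hdeep hexact


end Summit.BirchSwinnertonDyer.BirchSwinnertonDyer.Theorems.GenusKoly

end
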